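/-
Origin: expansion seat `planner-pub-hodgecm-qw8-0`, handover v7 2026-08-18T04:00:44Z (`HOME/pub-hodgecm-qw8/v7/Qw8GeometricCorCM.lean`, md5 e3bcd3ad, 58 lines);
landed by the gen-5 packager in gate run 21 REPLACES the earlier landed copy of `HodgeCM/Assembly/CorCMQw8Facts.lean` (import ^import Qw8Geometric\b→import HodgeCM.StubTree.Qw8Geometric ×1; stripped 2 #print/#check lines).
-/
/-
Copyright (c) 2026. All rights reserved.
Released under Apache 2.0 license as described in the file LICENSE.
-/
import Summits.HodgeConjecture.HodgeCM.Assembly.CorCM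
import Summits.HodgeConjecture.HodgeCM.Proofs.PohlmannSpan
import Summits.HodgeConjecture.HodgeCM.StubTree.Qw8Geometric

/-!
# COR-CM with every [QW8] step but Milne 1999 discharged

`HodgeCM.Assembly.COR_CM_of_qw8Steps` (`Assembly/CorCMQw8.lean`) takes the three [QW8] Thm 2.5 steps
`Qw8ExtProd`, `Qw8DualPushPull`, `Qw8Milne` as hypotheses.  With `HodgeCM.Universe.qw8ExtProd_of_facts` and
`qw8DualPushPull_of_facts` (`Qw8Geometric`, v7), the first two are theorems of any universe satisfying the model
axioms and the FIVE standard facts F2, F4–F7 (`Universe.Fact_factorActDescends`, `Fact_cupAlg`,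
`Fact_cupAssoc`, `Fact_weightDual`, `Fact_gysin` — CM action on products through factor-wise pull-backs,
intersection product, associativity of `∪`, Poincaré duality of the weight decomposition, Gysin/projection
formula; v4's candidate facts F1 block projections and F3 Künneth non-degeneracy are the theorems
`Universe.blockPair_exists`, `Universe.box_ne_zero`), so the Hodge conjecture for CM abelian varieties follows
from: the model axioms M1–M28, F2, F4–F7, the theta realisation over a rank-four face (`RealisationExistsFace`),
Pohlmann's span theorem (print) and Milne 1999 (print, `Qw8Milne`); with `Universe.pohlmannSpan_holds`
(run 17: `PohlmannSpan` ⇐ M29 `Fact_weightSpan` ∧ M30 `Fact_weightHodge`) the whole GEOMETRIC side of COR-CM is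
reduced to named standard facts of the model:
`COR_CM_of_geometricFacts : HC_CM ⇐ ModelAxioms ∧ M29 ∧ M30 ∧ F2 ∧ F4–F7 ∧ RealisationExistsFace ∧ Qw8Milne`.
One-liners; recorded so that the closure audit displays the finer inputs.
(WIP import name `Qw8Geometric` = `pub-hodgecm-qw8/v7/Qw8Geometric.lean` → `HodgeCM.StubTree.Qw8Geometric`;
the packager renames.)
-/

noncomputable section

namespace HodgeCM

namespace Assembly

/-- **COR-CM from the model axioms, the standard facts F2, F4–F7, the face realisation, Pohlmann, and Milne 1999.** -/
theorem COR_CM_of_qw8Facts (U : Universe) (M : U.ModelAxioms) (hR : U.RealisationExistsFace)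
    (hP : U.PohlmannSpan) (h2 : U.Fact_factorActDescends) (h4 : U.Fact_cupAlg) (h5 : U.Fact_cupAssoc)
    (h6 : U.Fact_weightDual) (h7 : U.Fact_gysin)
    (hMi : U.Qw8Milne) : U.HC_CM :=
  COR_CM U M hR hP (U.qw8Sufficiency_of_facts M h2 h4 h5 h6 h7 hMi)

/-- **COR-CM with the geometric side reduced to standard facts**: the Hodge conjecture for CM abelian varieties
from the model axioms M1–M28, M29–M30 (`Fact_weightSpan`, `Fact_weightHodge`), F2, F4–F7, the theta realisation over
a rank-four face (`RealisationExistsFace`, PerL side) and Milne 1999 (`Qw8Milne`, print). -/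
theorem COR_CM_of_geometricFacts (U : Universe) (M : U.ModelAxioms) (hR : U.RealisationExistsFace)
    (h29 : U.Fact_weightSpan) (h30 : U.Fact_weightHodge) (h2 : U.Fact_factorActDescends) (h4 : U.Fact_cupAlg)
    (h5 : U.Fact_cupAssoc) (h6 : U.Fact_weightDual) (h7 : U.Fact_gysin) (hMi : U.Qw8Milne) : U.HC_CM :=
  COR_CM U M hR (U.pohlmannSpan_holds M h29 h30) (U.qw8Sufficiency_of_facts M h2 h4 h5 h6 h7 hMi)

end Assembly

end HodgeCM

end

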